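import Summits.QuantumFields.BalabanUV.Beta.FP.NestedDressingKernel
import Summits.QuantumFields.BalabanUV.Beta.FP.NestedDressingProjectorCovariance
import Summits.QuantumFields.BalabanUV.Beta.SymmetrisedDressingReflection

/-!
# `BalabanUV.Beta.FP.NestedDressingKernelCovariance` — road «FP» for binder row D1, R-FP-45 (B), row NESTED-DRESS, FILE 6: THE NESTED PROJECTOR KERNEL AT THE
# CENTRED ROOT IS PERMUTATION-INVARIANT — `permK (axisPerm σ) (piKSymNest ρ_c Lc m) = piKSymNest ρ_c Lc m` (the kernel form of FILE 5's `symAxProjNestAt_ctr_P1`,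
# an2's `permK_piKSymBm` one level up) AND REFLECTION-INVARIANT for `Lc` odd (`refK (Φ N' α) (piKSymNest ρ_c Lc m) = piKSymNest ρ_c Lc m`, an2's
# `refK_piKSymBm`), so an2's `permK_coDressKSymAt` ∕ `refK_coDressKSymAt` symmetry transport re-instantiates for the nested-dressed families

HONEST DEPENDENCY (page 1, mandatory): continuum YM on T⁴ ⇐ BetaPertH ∧ nine spine estimates (0/9 proved); BetaPertH ⇐ (D1) ∧ (D4) ∧ CAP+tail;
G-an2-4 gates asym, D1 and NE2/3/4.  HONEST FRAMING (cell contract, verbatim): «discharging `BetaPertH` makes Bałaban's UV stability UNCONDITIONAL —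
a real constructive-QFT result; it is NOT the continuum limit and NOT the Clay problem.»  THIS MODULE DISCHARGES NOTHING of the wall: [folklore] index
bookkeeping (generic `n` for the matrix, `d+1` for the kernel; centred root `ctr`).  No `def`, no `def … : Prop`, nothing cited, 0 sorry; 0∕4 row-D1 binders;
NOT SDF, NOT D1, NOT BetaPertH, NOT continuum, NOT Clay.  «not in print; our bookkeeping».

ABSOLUTE RULE (cell charter, verbatim): «No internally-minted statement may enter as a cited fact. Every hypothesis is either kernel-proved in this package or a
verbatim quotation of a PUBLISHED theorem with page reference. The manuscript(s) under audit are NOT citable for their own disputed steps — they are the thing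
under adjudication; programme-internal (2001/route/tribunal) claims are never citable.»

CONTENTS ([folklore]): `pmSymNest_perm` (`pmSymNest ρ_c Lc m (σ β) (σ•p) (σ α) (σ•q) = pmSymNest ρ_c Lc m β p α q`), **`permK_piKSymNest`**, and the matrix
reflection law **`pmSymNest_refl`** (`Lc` odd), the coordinate window `pmSymNest_ne_zero`, the reflected window `window_refl_of_pmSymNest_ne_zero`, and
**`refK_piKSymNest`** (`refK (Φ N' α) (piKSymNest ρ_c Lc m) = piKSymNest ρ_c Lc m` — an2's `refK_piKSymBm` one level up).
Provenance: road FP swarm LEAF PROVER `b2b-balaban-beta-d1-formalise-leaf-06` gen 14, 2026-08-21, row NESTED-DRESS.  Names PROVISIONAL.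
-/

noncomputable section

open Literature.MathematicalPhysics.QuantumFieldTheory
open Literature.MathematicalPhysics.QuantumFieldTheory.Balaban1983to89
open Literature.MathematicalPhysics.QuantumFieldTheory.Balaban1983to89.Beta
open ExpKernelCalculus (MKer)
open AffineAveraging (Form0 Form1 Site toSite)
open AveragingContoursRooted (ctr ctrOff)
open RootedComb (ctr_eq_toSite)
open PolarizationSign (reflSign)
open ResolventReflection (bref bref_apply R1 reflSign_mul_self mref Φ Φ_r_inl Φ_r_inr Φ_s_inl Φ_s_inr)
open KernelReflection (refK refK_apply)
open AxialProjector (zsmul_blk_le lt_zsmul_blk_add)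
open AffineAveraging (unitVec unitVec_apply box)
open AveragingContours (blk)
open OneStepResolventKernel (Fib)
open Summit.QuantumFields.BalabanUV.Beta.KernelPermutation (psite psite_apply psite_sub psite_inv_psite permK axisPerm permK_axisPerm_apply axisPerm_π_inl
  axisPerm_π_inr)
open Summit.QuantumFields.BalabanUV.Beta.ResolventPermutation (P1 P1_apply)
open Summit.QuantumFields.BalabanUV.Beta.AxialDressingRooted (cube mem_cube R1_bondInd mref_inj)
open Summit.QuantumFields.BalabanUV.Beta.SymmetrisedDressingMatrix (bondIndR bondIndR_apply P1_bondIndR)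
open Summit.QuantumFields.BalabanUV.Beta.SymmetrisedDressingKernel (psite_mem_cube_iff)
open Summit.QuantumFields.BalabanUV.Beta.FP.NestedDressingProjector (symAxProjNestAt)
open Summit.QuantumFields.BalabanUV.Beta.FP.NestedDressingProjectorCovariance (symAxProjNestAt_ctr_P1 symAxProjNestAt_R1)
open Summit.QuantumFields.BalabanUV.Beta.FP.NestedDressingProjectorBounds (symAxProjNestAt_smul symAxProjNestAt_apply_eq_zero_of_vanish)
open Summit.QuantumFields.BalabanUV.Beta.FP.NestedDressingKernel

namespace Summit.QuantumFields.BalabanUV.Beta.FP.NestedDressingKernelCovariance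

/-- [folklore] **PERMUTATION COVARIANCE OF THE NESTED MATRIX** at the centred root: `pmSymNest ρ_c Lc m (σ β) (σ•p) (σ α) (σ•q) = pmSymNest ρ_c Lc m β p α q`
(FILE 5's `symAxProjNestAt_ctr_P1`, exactly as an2's `pmSymBm_perm`). -/
theorem pmSymNest_perm {n : ℕ} (σ : Equiv.Perm (Fin n)) (Lc m : ℕ) (β : Fin n) (p : Fin n → ℤ) (α : Fin n) (q : Fin n → ℤ) :
    pmSymNest (ctr n Lc) Lc m (σ β) (psite σ p) (σ α) (psite σ q) = pmSymNest (ctr n Lc) Lc m β p α q := by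
  have hb : bondIndR (σ α) (psite σ q) = P1 σ⁻¹ (bondIndR α q) := by
    rw [P1_bondIndR]; rfl
  rw [pmSymNest, pmSymNest, hb, symAxProjNestAt_ctr_P1, P1_apply, psite_inv_psite]
  have e : σ⁻¹ (σ β) = β := σ.symm_apply_apply β
  rw [e]

/-- [folklore] **`piKSymNest` AT THE CENTRED ROOT IS PERMUTATION-INVARIANT**: `permK (axisPerm σ) (piKSymNest ρ_c Lc m) = piKSymNest ρ_c Lc m`. -/
theorem permK_piKSymNest {d : ℕ} (σ : Equiv.Perm (Fin (d + 1))) (Lc m : ℕ) :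
    permK (axisPerm σ) (piKSymNest (ctr (d + 1) Lc) Lc m) = piKSymNest (ctr (d + 1) Lc) Lc m := by
  funext x x' a b
  rw [permK_axisPerm_apply]
  rcases a with α | μ <;> rcases b with β | μ'
  · rw [axisPerm_π_inl, axisPerm_π_inl, piKSymNest_inl_inl, piKSymNest_inl_inl, ← psite_sub]
    by_cases h : x' - x ∈ cube (d + 1) (Lc ^ m)
    · rw [if_pos ((psite_mem_cube_iff σ (Lc ^ m) _).2 h), if_pos h, pmSymNest_perm]
    · rw [if_neg (fun h' => h ((psite_mem_cube_iff σ (Lc ^ m) _).1 h')), if_neg h]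
  · rw [axisPerm_π_inl, axisPerm_π_inr, piKSymNest_inl_inr, piKSymNest_inl_inr]
  · rw [axisPerm_π_inr, axisPerm_π_inl, piKSymNest_inr_inl, piKSymNest_inr_inl]
  · rw [axisPerm_π_inr, axisPerm_π_inr, piKSymNest_inr_inr, piKSymNest_inr_inr]
    simp only [EmbeddingLike.apply_eq_iff_eq, (psite σ).injective.eq_iff]


/-- [folklore] **THE REFLECTION LAW OF THE NESTED MATRIX** (centred root, `Lc` odd): `pmSymNest ρ_c Lc m b p a q = ε_a ε_b · pmSymNest ρ_c Lc m b (bref α b p) a (bref α a q)`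
(FILE 5's `symAxProjNestAt_R1` + `R1_bondInd` + FILE 3's `symAxProjNestAt_smul`; an2's `pmSymBm_refl` one level up — the input of the kernel-level reflection
invariance, whose coordinate-window half is left to the successor file). -/
theorem pmSymNest_refl {d Lc : ℕ} (hLc : Odd Lc) (m : ℕ) (α b : Fin (d + 1)) (p : Fin (d + 1) → ℤ) (a : Fin (d + 1)) (q : Fin (d + 1) → ℤ) :
    pmSymNest (toSite (ctrOff (d + 1) Lc)) Lc m b p a q =
      reflSign α a * reflSign α b * pmSymNest (toSite (ctrOff (d + 1) Lc)) Lc m b (bref α b p) a (bref α a q) := by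
  have key := congrFun (congrFun (symAxProjNestAt_R1 hLc α m (bondIndR a (bref α a q))) b) p
  rw [← ctr_eq_toSite]
  unfold pmSymNest
  have eR : R1 α (symAxProjNestAt (ctr (d + 1) Lc) Lc m (bondIndR a (bref α a q))) b p =
      reflSign α b * symAxProjNestAt (ctr (d + 1) Lc) Lc m (bondIndR a (bref α a q)) b (bref α b p) := rfl
  have eL : symAxProjNestAt (ctr (d + 1) Lc) Lc m (R1 α (bondIndR a (bref α a q))) b p =
      reflSign α a * symAxProjNestAt (ctr (d + 1) Lc) Lc m (bondIndR a q) b p := by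
    have hR : R1 α (bondIndR a (bref α a q)) = reflSign α a • bondIndR a q := by
      have h := R1_bondInd α a q
      funext κ x
      have hκ := congrFun (congrFun h κ) x
      simp only [Pi.smul_apply, smul_eq_mul]
      unfold bondIndR
      exact hκ
    rw [hR, symAxProjNestAt_smul]
    rfl
  rw [eL, eR] at key
  have hs := reflSign_mul_self α a
  calc symAxProjNestAt (ctr (d + 1) Lc) Lc m (bondIndR a q) b p
      = reflSign α a * reflSign α a * symAxProjNestAt (ctr (d + 1) Lc) Lc m (bondIndR a q) b p := by rw [hs, one_mul]
    _ = reflSign α a * (reflSign α b * symAxProjNestAt (ctr (d + 1) Lc) Lc m (bondIndR a (bref α a q)) b (bref α b p)) := by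
        rw [mul_assoc, key]
    _ = _ := by ring


/-! ## §3 The coordinate window, the reflected window, and reflection invariance of the kernel (`Lc` odd) -/

/-- [folklore] **SUPPORT OF `pmSymNest` IN COORDINATES** (in-block root, `Lc ≥ 1`): `pmSymNest (toSite r) Lc m b p a q ≠ 0` forces `|p_i − q_i| ≤ Lc^m − 1` for
`i ≠ b` and `−Lc^m ≤ p_i − q_i ≤ Lc^m − 1` — the conclusion of an2's `pmSymBm_ne_zero` VERBATIM at `N = Lc^m` (so the reflected-window proof transplants). -/
theorem pmSymNest_ne_zero {d Lc : ℕ} (hLc : 1 ≤ Lc) {r : Fin (d + 1) → ℕ} (hr : r ∈ box (d + 1) Lc) {m : ℕ} {b : Fin (d + 1)}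
    {p : Fin (d + 1) → ℤ} {a : Fin (d + 1)} {q : Fin (d + 1) → ℤ} (h : pmSymNest (toSite r) Lc m b p a q ≠ 0) (i : Fin (d + 1)) :
    (i ≠ b → |p i - q i| ≤ ((Lc ^ m : ℕ) : ℤ) - 1) ∧ (-((Lc ^ m : ℕ) : ℤ) ≤ p i - q i ∧ p i - q i ≤ ((Lc ^ m : ℕ) : ℤ) - 1) := by
  have hN : 1 ≤ Lc ^ m := Nat.one_le_pow _ _ hLc
  -- the bond `(a,q)` lies in the `Lc^m`-block of `p`, or in that of `p + e_b`, or `(b,p) = (a,q)`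
  have hcase : blk (Lc ^ m) q = blk (Lc ^ m) p ∨ blk (Lc ^ m) q = blk (Lc ^ m) (p + unitVec b) ∨ (b = a ∧ p = q) := by
    by_cases h1 : blk (Lc ^ m) q = blk (Lc ^ m) p
    · exact Or.inl h1
    by_cases h2 : blk (Lc ^ m) q = blk (Lc ^ m) (p + unitVec b)
    · exact Or.inr (Or.inl h2)
    by_cases h3 : b = a ∧ p = q
    · exact Or.inr (Or.inr h3)
    exfalso
    apply h
    refine symAxProjNestAt_apply_eq_zero_of_vanish hLc hr m b p ?_ ?_ ?_
    · rw [bondIndR_apply, if_neg h3]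
    · intro κ' y hy _
      rw [bondIndR_apply, if_neg]
      rintro ⟨-, rfl⟩
      exact h1 hy
    · intro κ' y hy _
      rw [bondIndR_apply, if_neg]
      rintro ⟨-, rfl⟩
      exact h2 hy
  rcases hcase with k | k | ⟨-, hpq⟩
  · have a1 := zsmul_blk_le hN p i
    have a2 := lt_zsmul_blk_add hN p i
    have b1 := zsmul_blk_le hN q i
    have b2 := lt_zsmul_blk_add hN q i
    rw [k] at b1 b2
    refine ⟨fun _ => ?_, ?_, ?_⟩
    · rw [abs_le]; constructor <;> omega
    · omega
    · omega
  · have a1 := zsmul_blk_le hN (p + unitVec b) i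
    have a2 := lt_zsmul_blk_add hN (p + unitVec b) i
    have b1 := zsmul_blk_le hN q i
    have b2 := lt_zsmul_blk_add hN q i
    rw [k] at b1 b2
    simp only [Pi.add_apply, unitVec_apply] at a1 a2
    refine ⟨fun hib => ?_, ?_, ?_⟩
    · rw [if_neg hib] at a1 a2; rw [abs_le]; constructor <;> omega
    · by_cases hib : i = b
      · rw [if_pos hib] at a1 a2; omega
      · rw [if_neg hib] at a1 a2; omega
    · by_cases hib : i = b
      · rw [if_pos hib] at a1 a2; omega
      · rw [if_neg hib] at a1 a2; omega
  · subst hpq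
    refine ⟨fun _ => ?_, ?_, ?_⟩
    · rw [sub_self, abs_zero]; omega
    · rw [sub_self]; omega
    · rw [sub_self]; omega

/-- [folklore] **THE REFLECTED WINDOW**: `pmSymNest ≠ 0 ⇒ bref α b p − bref α a q ∈ cube (Lc^m)` (an2's `window_refl_of_pmSymBm_ne_zero`, same proof). -/
theorem window_refl_of_pmSymNest_ne_zero {d Lc : ℕ} (hLc : 1 ≤ Lc) {r : Fin (d + 1) → ℕ} (hr : r ∈ box (d + 1) Lc) {m : ℕ} {b : Fin (d + 1)}
    {p : Fin (d + 1) → ℤ} {a : Fin (d + 1)} {q : Fin (d + 1) → ℤ} (h : pmSymNest (toSite r) Lc m b p a q ≠ 0) (α : Fin (d + 1)) :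
    bref α b p - bref α a q ∈ cube (d + 1) (Lc ^ m) := by
  rw [mem_cube]
  intro i
  have k := pmSymNest_ne_zero hLc hr h i
  rw [Pi.sub_apply, bref_apply, bref_apply, abs_le]
  by_cases hiα : i = α
  · rw [if_pos hiα, if_pos hiα]
    by_cases hb : b = α <;> by_cases ha : a = α
    · rw [if_pos hb, if_pos ha]; have := k.2; constructor <;> omega
    · rw [if_pos hb, if_neg ha]; have := k.2; constructor <;> omega
    · rw [if_neg hb, if_pos ha]
      have hib : i ≠ b := fun e => hb (e ▸ hiα)
      have := abs_le.1 (k.1 hib); constructor <;> omega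
    · rw [if_neg hb, if_neg ha]
      have := k.2; constructor <;> omega
  · rw [if_neg hiα, if_neg hiα]
    have := k.2; constructor <;> omega

/-- [folklore] **REFLECTION INVARIANCE OF THE NESTED PROJECTOR KERNEL** (centred root, `Lc` odd, every axis `α`, any multiplier-leg blocking `N'` of the leg map):
`refK (Φ N' α) (piKSymNest ρ_c Lc m) = piKSymNest ρ_c Lc m` — an2's `refK_piKSymBm` one level up. -/
theorem refK_piKSymNest {d Lc : ℕ} (hLc : Odd Lc) (m N' : ℕ) (α : Fin (d + 1)) :
    refK (Φ N' α) (piKSymNest (toSite (ctrOff (d + 1) Lc)) Lc m) = piKSymNest (d := d) (toSite (ctrOff (d + 1) Lc)) Lc m := by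
  have hL1 : 1 ≤ Lc := hLc.pos
  have hr : ctrOff (d + 1) Lc ∈ box (d + 1) Lc := AveragingContoursRooted.ctrOff_mem_box hL1
  funext x x' u v
  rw [refK_apply]
  rcases u with a | μ <;> rcases v with b | μ'
  · simp only [Φ_s_inl, Φ_r_inl, piKSymNest_inl_inl]
    by_cases h0 : pmSymNest (toSite (ctrOff (d + 1) Lc)) Lc m b x' a x = 0
    · have h0' : pmSymNest (toSite (ctrOff (d + 1) Lc)) Lc m b (bref α b x') a (bref α a x) = 0 := by
        have e := pmSymNest_refl hLc m α b x' a x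
        rw [h0] at e
        have hsa := reflSign_mul_self α a
        have hsb := reflSign_mul_self α b
        have : reflSign α a * reflSign α b ≠ 0 := by
          intro hz
          have := congrArg (fun t => t * (reflSign α a * reflSign α b)) hz
          simp only [zero_mul] at this
          nlinarith [hsa, hsb]
        rcases mul_eq_zero.1 e.symm with h1 | h1
        · exact absurd h1 this
        · exact h1
      rw [h0']
      split_ifs <;> simp [h0]
    · rw [if_pos (window_refl_of_pmSymNest_ne_zero hL1 hr h0 α), if_pos (window_of_pmSymNest_ne_zero hL1 hr h0), pmSymNest_refl hLc m α b x' a x]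
  · simp [piKSymNest_inl_inr]
  · simp [piKSymNest_inr_inl]
  · simp only [Φ_s_inr, Φ_r_inr, piKSymNest_inr_inr]
    by_cases hm : μ = μ'
    · subst hm
      rw [reflSign_mul_self, one_mul]
      by_cases hx : x = x'
      · subst hx; simp
      · have hx' : mref N' α μ x ≠ mref N' α μ x' := fun e => hx (mref_inj.1 e)
        simp [hx, hx']
    · simp [hm]

end Summit.QuantumFields.BalabanUV.Beta.FP.NestedDressingKernelCovariance

end
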